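import Summits.CriticalPhenomena.CardyFormulaZ2.Theorems.IKMixedBoxCrossing.Negative.IKMixedBoxCrossingSmallModels

/-!
# `IKMixedBoxCrossing` (crux stmt-CriticalPhenomena-5911): the colour field is NOT positively associated

Negative-side support lemma from the standing disprover (refuter, cdisprove lane); continues
`IKMixedBoxCrossingSmallModels` (same namespace, gauge names from there). Nothing here asserts a
Theses decl positively.
-/

namespace Summit.CriticalPhenomena.CardyFormulaZ2.Theorems.IKMixedBoxCrossing.Negative

open scoped Classical ENNReal
open MeasureTheory ProbabilityTheory unitInterval
open Literature.Probability.Percolation Literature.Probability.LatticeModels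
open Summit.CriticalPhenomena.CardyFormulaZ2.Theses.CardyIKTransport (IKMixedBoxCrossing)

noncomputable section

/-! ## §4 Load-bearing obstruction: the colour field is NOT positively associated

Harris–FKG fails for the law of the colours (already at the level of one face of an `S`-column), so
no proof of the crux can run the standard RSW machinery (Russo–Seymour–Welsh, Kesten's
square-root trick, Köhler-Schindler–Tassion arXiv:2011.04618 Thm 1, Grimmett–Manolescu transport
arXiv:1204.0505) on the colour field as a positively associated measure. Witness (route docstring,
refuter reviews on stmt-5911, here kernel-checked): with `p = 2√3 − 3` the plaquette defect
probability, `P({c(0,0) ∨ c(1,0)} ∩ {c(0,1) ∧ c(1,1)}) = (1 + p)/8 < 3/16 = (3/4)·(1/4)`, i.e.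
covariance `(p − 1/2)/8 = −ρ/16`, `ρ = (1 − t)/(1 + t)`. Off `S` (fair plaquettes, `p = 1/2`) the four
colours of a face are independent and the covariance vanishes. -/

/-- general two-coordinate cylinder of the fair column signs -/
theorem μA_two (P Q : Prop) :
    sitePercolation ℤ half {A : Set ℤ | (0 ∈ A ↔ P) ∧ (1 ∈ A ↔ Q)} = toNNReal half * toNNReal half := by
  rw [sitePercolation, setBernoulli_apply']
  have : (fun p : ℤ → Prop ↦ {i | p i}) ⁻¹' {A : Set ℤ | (0 ∈ A ↔ P) ∧ (1 ∈ A ↔ Q)}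
      = Set.pi (({0, 1} : Finset ℤ) : Set ℤ) (fun i => if i = 0 then {q : Prop | q ↔ P} else {q : Prop | q ↔ Q}) := by
    ext f; simp
  rw [this, Measure.infinitePi_pi _ (fun _ _ => MeasurableSpace.measurableSet_top),
    Finset.prod_pair (by norm_num)]
  have hfac : ∀ (i : ℤ) (R : Prop), (toNNReal half • Measure.dirac (i ∈ (Set.univ : Set ℤ)) +
      toNNReal (σ half) • Measure.dirac False) {q : Prop | q ↔ R} = toNNReal half := by
    intro i R
    by_cases hR : R
    · simp [Set.indicator, hR]
    · simp [Set.indicator, hR, symm_half]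
  simp only [if_true, one_ne_zero, if_false, hfac]

/-- `toNNReal ½ = 2⁻¹` in `ℝ≥0`. [folklore] -/
theorem toNNReal_half : toNNReal half = 2⁻¹ := by
  apply NNReal.coe_injective
  simp [coe_toNNReal]

/-- `toNNReal ½ = 2⁻¹` in `ℝ≥0∞`. [folklore] -/
theorem coe_toNNReal_half : (toNNReal half : ℝ≥0∞) = 2⁻¹ := by
  rw [toNNReal_half, ENNReal.coe_inv two_ne_zero, ENNReal.coe_ofNat]

/-- `(½)² = ¼` in `ℝ≥0∞`. [folklore] -/
theorem toNNReal_half_mul : (toNNReal half : ℝ≥0∞) * toNNReal half = 4⁻¹ := by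
  rw [coe_toNNReal_half, ← ENNReal.mul_inv (Or.inl two_ne_zero) (Or.inl (by norm_num))]
  norm_num

/-- Fair column signs: every two-coordinate cylinder `{(0 ∈ A ↔ P) ∧ (1 ∈ A ↔ Q)}` has mass `¼`. [folklore] -/
theorem μA_two' (P Q : Prop) :
    sitePercolation ℤ half {A : Set ℤ | (0 ∈ A ↔ P) ∧ (1 ∈ A ↔ Q)} = 4⁻¹ := by
  rw [μA_two, toNNReal_half_mul]

/-- The plaquette defect probability of the gauge as a point of the unit interval. -/
def pDef : unitInterval := Set.projIcc (0:ℝ) 1 zero_le_one (2 * Real.sqrt 3 - 3)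

/-- `3/2 < √3 < 7/4`. [folklore] -/
theorem sqrt3_bounds : (3:ℝ)/2 < Real.sqrt 3 ∧ Real.sqrt 3 < 7/4 := by
  have h := Real.sq_sqrt (show (0:ℝ) ≤ 3 by norm_num)
  have h0 := Real.sqrt_nonneg 3
  constructor <;> nlinarith

/-- The defect probability is `2√3 − 3` (it lies in `[0,1]`, so `projIcc` is the identity). [folklore] -/
theorem coe_pDef : (pDef : ℝ) = 2 * Real.sqrt 3 - 3 := by
  have ⟨h1, h2⟩ := sqrt3_bounds
  rw [pDef, Set.projIcc_of_mem]
  constructor <;> linarith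

/-- `2√3 − 3 < ½`: defects are (slightly) disfavoured, `t = √3/2 < 1`. [folklore] -/
theorem pDef_lt_half : (pDef : ℝ) < 1 / 2 := by
  rw [coe_pDef]; have := sqrt3_bounds.2; linarith

/-- one-coordinate cylinder of the biased plaquette field -/
theorem μP_mem (f : Site 2) :
    sitePercolation (Site 2) (Set.projIcc (0:ℝ) 1 zero_le_one (2 * Real.sqrt 3 - 3)) {P : Set (Site 2) | f ∈ P} =
      toNNReal pDef := by
  rw [sitePercolation, setBernoulli_apply']
  have : (fun p : Site 2 → Prop ↦ {i | p i}) ⁻¹' {P : Set (Site 2) | f ∈ P}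
      = Set.pi (({f} : Finset (Site 2)) : Set (Site 2)) (fun _ => {q : Prop | q}) := by
    ext g; simp
  rw [this, Measure.infinitePi_pi _ (fun _ _ => MeasurableSpace.measurableSet_top), Finset.prod_singleton]
  simp [Set.indicator, pDef]

/-- the increasing colour events `E₁ = {c(0,0) ∨ c(1,0)}` and `E₂ = {c(0,1) ∧ c(1,1)}` in bit form
(valid when `0 ∈ S`) -/
def E₁ : Set Ω := {ω | Xor (0 ∈ ω.1) (0 ∈ ω.2.1) ∨ Xor (1 ∈ ω.1) (0 ∈ ω.2.1)}
/-- The increasing colour event `{c(0,1) ∧ c(1,1)}` in bit form (valid when `0 ∈ S`). [folklore] -/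
def E₂ : Set Ω := {ω | Xor (0 ∈ ω.1) (1 ∈ ω.2.1) ∧ Xor (1 ∈ ω.1) (Xor (1 ∈ ω.2.1) (![0, 0] ∈ ω.2.2.1))}
/-- the set of hidden bits on which the two events are compatible -/
def G : Set Rest := {y | (0 ∈ y.1 ↔ 1 ∈ y.1) ∨ ![0, 0] ∈ y.2.1}

/-- Coordinate measurability: `A₀`. [folklore] -/
theorem measurable_A0 : Measurable fun ω : Ω => (0 : ℤ) ∈ ω.1 := (measurable_set_mem 0).comp measurable_fst
/-- Coordinate measurability: `A₁`. [folklore] -/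
theorem measurable_A1 : Measurable fun ω : Ω => (1 : ℤ) ∈ ω.1 := (measurable_set_mem 1).comp measurable_fst
/-- Coordinate measurability: `B₀`. [folklore] -/
theorem measurable_B0 : Measurable fun ω : Ω => (0 : ℤ) ∈ ω.2.1 :=
  (measurable_set_mem 0).comp (measurable_fst.comp measurable_snd)
/-- Coordinate measurability: `B₁`. [folklore] -/
theorem measurable_B1 : Measurable fun ω : Ω => (1 : ℤ) ∈ ω.2.1 :=
  (measurable_set_mem 1).comp (measurable_fst.comp measurable_snd)
/-- Coordinate measurability: the biased plaquette bit at the origin face. [folklore] -/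
theorem measurable_P00 : Measurable fun ω : Ω => ![0, 0] ∈ ω.2.2.1 :=
  (measurable_set_mem _).comp (measurable_fst.comp (measurable_snd.comp measurable_snd))

/-- `Xor` of measurable propositions is measurable. [folklore] -/
theorem measurable_xor {α : Type*} [MeasurableSpace α] {p q : α → Prop} (hp : Measurable p) (hq : Measurable q) :
    Measurable fun a => Xor (p a) (q a) :=
  (hp.and hq.not).or (hq.and hp.not)

/-- `E₁` is measurable. [folklore] -/
theorem measurableSet_E₁ : MeasurableSet E₁ :=
  measurableSet_setOf.2 ((measurable_xor measurable_A0 measurable_B0).or (measurable_xor measurable_A1 measurable_B0))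

/-- `E₂` is measurable. [folklore] -/
theorem measurableSet_E₂ : MeasurableSet E₂ :=
  measurableSet_setOf.2 ((measurable_xor measurable_A0 measurable_B1).and
    (measurable_xor measurable_A1 (measurable_xor measurable_B1 measurable_P00)))

/-- `G` is measurable. [folklore] -/
theorem measurableSet_G : MeasurableSet G :=
  measurableSet_setOf.2 ((((measurable_set_mem 0).comp measurable_fst).iff ((measurable_set_mem 1).comp measurable_fst)).or
    ((measurable_set_mem _).comp (measurable_fst.comp measurable_snd)))

/-- Every `A`-slice of `E₂` is a two-coordinate cylinder of mass `¼`. [folklore] -/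
theorem slice_E₂ (y : Rest) :
    sitePercolation ℤ half ((fun A : Set ℤ => (A, y)) ⁻¹' E₂) = 4⁻¹ := by
  have : (fun A : Set ℤ => (A, y)) ⁻¹' E₂ =
      {A : Set ℤ | (0 ∈ A ↔ ¬ (1 ∈ y.1)) ∧ (1 ∈ A ↔ ¬ Xor (1 ∈ y.1) (![0, 0] ∈ y.2.1))} := by
    ext A; simp only [E₂, Xor, Set.mem_preimage, Set.mem_setOf_eq]; tauto
  rw [this, μA_two']

/-- Every `A`-slice of `E₁` is the complement of a two-coordinate cylinder: mass `¾`. [folklore] -/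
theorem slice_E₁ (y : Rest) :
    sitePercolation ℤ half ((fun A : Set ℤ => (A, y)) ⁻¹' E₁) = 1 - 4⁻¹ := by
  have hset : (fun A : Set ℤ => (A, y)) ⁻¹' E₁ = {A : Set ℤ | (0 ∈ A ↔ (0 ∈ y.1)) ∧ (1 ∈ A ↔ (0 ∈ y.1))}ᶜ := by
    ext A; simp only [E₁, Xor, Set.mem_preimage, Set.mem_setOf_eq, Set.mem_compl_iff]; tauto
  have hmeas : MeasurableSet {A : Set ℤ | (0 ∈ A ↔ (0 ∈ y.1)) ∧ (1 ∈ A ↔ (0 ∈ y.1))} :=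
    measurableSet_setOf.2 (((measurable_set_mem 0).iff measurable_const).and
      ((measurable_set_mem 1).iff measurable_const))
  rw [hset, measure_compl hmeas (measure_ne_top _ _), measure_univ, μA_two']

/-- The `A`-slice of `E₁ ∩ E₂` has mass `¼` on `G` and `0` off `G`. [folklore] -/
theorem slice_E₁E₂ (y : Rest) :
    sitePercolation ℤ half ((fun A : Set ℤ => (A, y)) ⁻¹' (E₁ ∩ E₂)) = G.indicator (fun _ => (4⁻¹ : ℝ≥0∞)) y := by
  by_cases hG : y ∈ G
  · rw [Set.indicator_of_mem hG]
    have : (fun A : Set ℤ => (A, y)) ⁻¹' (E₁ ∩ E₂) =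
        {A : Set ℤ | (0 ∈ A ↔ ¬ (1 ∈ y.1)) ∧ (1 ∈ A ↔ ¬ Xor (1 ∈ y.1) (![0, 0] ∈ y.2.1))} := by
      ext A
      simp only [E₁, E₂, G, Xor, Set.mem_preimage, Set.mem_inter_iff, Set.mem_setOf_eq] at hG ⊢
      tauto
    rw [this, μA_two']
  · rw [Set.indicator_of_notMem hG]
    have : (fun A : Set ℤ => (A, y)) ⁻¹' (E₁ ∩ E₂) = ∅ := by
      ext A
      simp only [E₁, E₂, G, Xor, Set.mem_preimage, Set.mem_inter_iff, Set.mem_setOf_eq,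
        Set.mem_empty_iff_false, iff_false] at hG ⊢
      tauto
    rw [this, measure_empty]

/-- `P(E₂) = ¼` (Fubini over the hidden bits). [folklore] -/
theorem μIK_E₂ : μIK E₂ = 4⁻¹ := by
  rw [μIK_eq, Measure.prod_apply_symm measurableSet_E₂]
  simp only [slice_E₂, lintegral_const, measure_univ, mul_one]

/-- `P(E₁) = ¾` (Fubini over the hidden bits). [folklore] -/
theorem μIK_E₁ : μIK E₁ = 1 - 4⁻¹ := by
  rw [μIK_eq, Measure.prod_apply_symm measurableSet_E₁]
  simp only [slice_E₁, lintegral_const, measure_univ, mul_one]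

/-- `P(E₁ ∩ E₂) = ¼ · P(G)` (Fubini over the hidden bits). [folklore] -/
theorem μIK_E₁E₂ : μIK (E₁ ∩ E₂) = 4⁻¹ * ν G := by
  rw [μIK_eq, Measure.prod_apply_symm (measurableSet_E₁.inter measurableSet_E₂)]
  simp only [slice_E₁E₂]
  rw [lintegral_indicator_const measurableSet_G]

/-- the hidden-bit event has probability `1/2 + p/2` -/
theorem ν_G : ν G = 2⁻¹ + 2⁻¹ * toNNReal pDef := by
  have hG : G = ({B : Set ℤ | (0 ∈ B ↔ True) ∧ (1 ∈ B ↔ True)} ×ˢ (Set.univ : Set (Set (Site 2) × (Set (Site 2) × Set (Site 2))))) ∪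
      (({B : Set ℤ | (0 ∈ B ↔ False) ∧ (1 ∈ B ↔ False)} ×ˢ Set.univ) ∪
      (({B : Set ℤ | (0 ∈ B ↔ True) ∧ (1 ∈ B ↔ False)} ∪ {B : Set ℤ | (0 ∈ B ↔ False) ∧ (1 ∈ B ↔ True)}) ×ˢ
        ({P : Set (Site 2) | ![0, 0] ∈ P} ×ˢ (Set.univ : Set (Set (Site 2) × Set (Site 2)))))) := by
    ext y
    simp only [G, Set.mem_setOf_eq, Set.mem_union, Set.mem_prod, Set.mem_univ, and_true, iff_true, iff_false]
    tauto
  have hm : ∀ P Q : Prop, MeasurableSet {B : Set ℤ | (0 ∈ B ↔ P) ∧ (1 ∈ B ↔ Q)} := fun P Q =>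
    measurableSet_setOf.2 (((measurable_set_mem 0).iff measurable_const).and ((measurable_set_mem 1).iff measurable_const))
  have h2 : sitePercolation ℤ half ({B : Set ℤ | (0 ∈ B ↔ True) ∧ (1 ∈ B ↔ False)} ∪
      {B : Set ℤ | (0 ∈ B ↔ False) ∧ (1 ∈ B ↔ True)}) = 4⁻¹ + 4⁻¹ := by
    rw [measure_union, μA_two', μA_two']
    · exact Set.disjoint_left.2 fun B h h' => (h'.1.1 (h.1.2 trivial)).elim
    · exact hm _ _
  rw [hG, measure_union, measure_union]
  · simp only [ν, Measure.prod_prod, measure_univ, mul_one, μA_two', h2, μP_mem]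
    have hq : (4:ℝ≥0∞)⁻¹ = 2⁻¹ * 2⁻¹ := by
      rw [← ENNReal.mul_inv (Or.inl two_ne_zero) (Or.inl (by norm_num))]; norm_num
    have hx : (2:ℝ≥0∞)⁻¹ * 2⁻¹ + 2⁻¹ * 2⁻¹ = 2⁻¹ := by
      rw [← mul_add, ENNReal.inv_two_add_inv_two, mul_one]
    rw [hq, hx, ← add_assoc, hx]
  · exact Set.disjoint_left.2 fun y h h' => by
      simp only [Set.mem_prod, Set.mem_setOf_eq, Set.mem_union] at h h'; tauto
  · exact ((hm _ _).union (hm _ _)).prod ((measurableSet_mem _).prod MeasurableSet.univ)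
  · exact Set.disjoint_left.2 fun y h h' => by
      simp only [Set.mem_prod, Set.mem_setOf_eq, Set.mem_union] at h h'; tauto
  · exact ((hm _ _).prod MeasurableSet.univ).union (((hm _ _).union (hm _ _)).prod ((measurableSet_mem _).prod MeasurableSet.univ))

/-- `P(E₂) = 1/4` as a real number. [folklore] -/
theorem μIK_real_E₂ : μIK.real E₂ = 1 / 4 := by
  rw [Measure.real, μIK_E₂, ENNReal.toReal_inv]; norm_num

/-- `P(E₁) = 3/4` as a real number. [folklore] -/
theorem μIK_real_E₁ : μIK.real E₁ = 3 / 4 := by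
  rw [Measure.real, μIK_E₁, ENNReal.toReal_sub_of_le (ENNReal.inv_le_one.2 (by norm_num)) ENNReal.one_ne_top,
    ENNReal.toReal_inv]
  norm_num

/-- `P(E₁ ∩ E₂) = (1 + p)/8` as a real number, `p = 2√3 − 3`. [folklore] -/
theorem μIK_real_E₁E₂ : μIK.real (E₁ ∩ E₂) = (1 + (pDef : ℝ)) / 8 := by
  rw [Measure.real, μIK_E₁E₂, ν_G, ENNReal.toReal_mul, ENNReal.toReal_add (by norm_num)
    (ENNReal.mul_ne_top (by norm_num) ENNReal.coe_ne_top), ENNReal.toReal_mul, ENNReal.toReal_inv,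
    ENNReal.toReal_inv, ENNReal.coe_toReal, coe_toNNReal]
  norm_num; ring

/-- NO POSITIVE ASSOCIATION: the increasing colour events `E₁`, `E₂` are negatively correlated. -/
theorem fkg_fails_on_a_face : μIK.real (E₁ ∩ E₂) < μIK.real E₁ * μIK.real E₂ := by
  rw [μIK_real_E₁E₂, μIK_real_E₁, μIK_real_E₂]
  have := pDef_lt_half
  nlinarith


/-- Colour of the cell `(0,1)` in bits: `A₀ ⊕ B₁` (empty defect rectangle). [folklore] -/
theorem blk_zero_one (S : Set ℤ) (ω : Ω) : ![0, 1] ∈ blackSet S ω ↔ Xor (0 ∈ ω.1) (1 ∈ ω.2.1) := by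
  simp [blackSet, Xor]

/-- Colour of the cell `(1,1)` in bits when column `0` is an `S`-column: `A₁ ⊕ B₁ ⊕ π₀₀` (the defect
rectangle is the single origin face, read from the biased field). [folklore] -/
theorem blk_one_one {S : Set ℤ} (hS : (0:ℤ) ∈ S) (ω : Ω) :
    ![1, 1] ∈ blackSet S ω ↔ Xor (1 ∈ ω.1) (Xor (1 ∈ ω.2.1) (![0, 0] ∈ ω.2.2.1)) := by
  have h1 : Finset.Ico (min (0:ℤ) 1) (max 0 1) = {0} := by decide
  simp only [blackSet, parSet, Set.mem_setOf_eq, Matrix.cons_val_zero, Matrix.cons_val_one, h1,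
    Finset.singleton_product_singleton, Finset.filter_singleton, hS, true_and, not_true, false_and, or_false]
  by_cases h : ![(0:ℤ), 0] ∈ ω.2.2.1
  · simp [h]
  · simp [h]

/-- `E₁` is the colour event `{c(0,0) ∨ c(1,0)}`. [folklore] -/
theorem E₁_eq (S : Set ℤ) : E₁ = {ω | ![0, 0] ∈ blackSet S ω ∨ ![1, 0] ∈ blackSet S ω} := by
  ext ω; simp only [E₁, Set.mem_setOf_eq, blk_zero_zero, blk_one_zero]

/-- `E₂` is the colour event `{c(0,1) ∧ c(1,1)}` when column `0` is an `S`-column. [folklore] -/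
theorem E₂_eq {S : Set ℤ} (hS : (0:ℤ) ∈ S) : E₂ = {ω | ![0, 1] ∈ blackSet S ω ∧ ![1, 1] ∈ blackSet S ω} := by
  ext ω; simp only [E₂, Set.mem_setOf_eq, blk_zero_one, blk_one_one hS]

/-- NO POSITIVE ASSOCIATION of the colour field (headline form): on the face at the origin of an
`S`-column, the increasing colour events `{c(0,0) ∨ c(1,0)}` and `{c(0,1) ∧ c(1,1)}` satisfy
`P(E₁ ∩ E₂) = (1+p)/8 < 3/16 = P(E₁) P(E₂)` (`p = 2√3 − 3 < 1/2`; covariance `−ρ/16`). -/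
theorem colourField_not_positivelyAssociated {S : Set ℤ} (hS : (0:ℤ) ∈ S) :
    μIK.real ({ω | ![0, 0] ∈ blackSet S ω ∨ ![1, 0] ∈ blackSet S ω} ∩ {ω | ![0, 1] ∈ blackSet S ω ∧ ![1, 1] ∈ blackSet S ω}) <
      μIK.real {ω | ![0, 0] ∈ blackSet S ω ∨ ![1, 0] ∈ blackSet S ω} * μIK.real {ω | ![0, 1] ∈ blackSet S ω ∧ ![1, 1] ∈ blackSet S ω} := by
  rw [← E₁_eq S, ← E₂_eq hS]
  exact fkg_fails_on_a_face



end

end Summit.CriticalPhenomena.CardyFormulaZ2.Theorems.IKMixedBoxCrossing.Negative
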